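import Summits.BirchSwinnertonDyer.BirchSwinnertonDyer.Theorems.AlignedTransportAtTwoBSDOfMainConjectureRankOneAtTwoEulerCharAtTwoKerGShaExponent
import Summits.BirchSwinnertonDyer.BirchSwinnertonDyer.Theorems.AlignedTransportAtTwoBSDOfMainConjectureRankOneAtTwoEulerCharAtTwoKerGEmbedding
import Summits.BirchSwinnertonDyer.BirchSwinnertonDyer.Theorems.AlignedTransportAtTwoBSDOfMainConjectureRankOneAtTwoEulerCharAtTwoAssemblyDivisible
import HarnessLib

/-!
# Route `AlignedTransportAtTwo`, crux C3′ `BSDOfMainConjectureRankOneAtTwo` (stmt-BirchSwinnertonDyer-23008), line `birth`,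
# the (L) road on the C3′ CELL: the (L) identity at a cell curve with NO bookkeeping hypothesis, and the open stub re-read as
# the HEIGHT-INDEX identity (H) `#ker θ · (log₂5)^r = u · Reg₂ · [E(ℚ) : E_𝒦]`

HONEST FRAMING (cell `bsd-f1-sign2`, attach seat `bsd-line-att-p3` g12 under the C3′ lead lineage `bsd-line-att-p1`;
`--supports stmt-BirchSwinnertonDyer-23008 --as helper`). BSD is NOT proved; C3′ is NOT closed; nothing is asserted. THEOREMS
ONLY (no `def`, no named fact, no `sorry`). Successor of `…KerGShaExponent` (same seat) and of att-p4 g7's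
`…AssemblyDivisible.schneiderLeadingTermFormulaAtTwoSqAt_iff_kerIndexAt_of_prop414` (KI).

* §1 `finite_localTowerKerPrimary_zero_of_isOrdinaryAt` — for `W/ℚ` globally minimal, good ORDINARY at `p`, cyclotomic `κ`: EVERY
  local kernel `𝒦_{v,0}[p^∞]` is finite (Greenberg Lemma 3.3 at `v ∤ p`, Lemma 3.4 at `v ∣ p`; tree theorems);
  `exists_level_kerIndexL_rat` — **THE (L) IDENTITY ON THE CELL**: `W/ℚ` globally minimal, `IsOrdinaryAt W p`, `E(ℚ)[p] = 0`,
  `κ` cyclotomic, `S ⊇ {p} ∪ {bad}` finite, `Ш(E/ℚ)[p^∞]` finite ⟹ at every level `k ≥ k₀`, for every Weil pairing and every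
  Poitou–Tate family: a bi-additive `B` computing the point obstruction with `E(ℚ)/E_𝒦` finite (`E_𝒦 = ker B.flip`) and
  **`#(A₀/Sel₀) · [E(ℚ) : E_𝒦] = ∏_{v∈S} #𝒦_{v,0}[p^∞]`**; `natCard_quotient_eq_prod_div_natCard_kerG` — hence the Cassels–Poitou–Tate
  index is THE SAME natural number `i_S := (∏_{v∈S} #𝒦_{v,0}[p^∞]) / #(A₀/Sel₀)` for every such datum (an integer unconditionally by
  Lagrange, tree `natCard_kerG_zero_dvd_prod_rat`).
* §2 `schneiderLeadingTermFormulaAtTwoSqAt_iff_heightIndexAt_of_prop414_of_localOrders` — **THE OPEN STUB OF C3′ AT A CELL CURVE ⟺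
  THE HEIGHT-INDEX IDENTITY (H)** `#ker θ · (log₂5)^{rank E(ℚ)} = u · Reg₂(Dh) · i_S` (plus `ker θ` finite, `#coker θ = 1`), CONDITIONAL
  on the two PRINT inputs of the line: Greenberg Prop. 4.14 at `2` (`h414`, as in KI) and the LOCAL ORDERS (Greenberg Lemmas 3.3/3.4
  at `2`: `∏_{v∈S} #𝒦_{v,0}[2^∞] = 2^{v₂(∏ c_v)} · #Ẽ(𝔽₂)(2)²`, hypothesis `hloc`). Pure bookkeeping over KI: multiply by `i_S` and
  cancel `#(A₀/Sel₀) ≠ 0`.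

READING. With §1, `i_S = [E(ℚ) : E_𝒦]` is the index of the points orthogonal to all local classes under `∑_v inv_v(· ∪ₑ κP)`
(Cassels–Poitou–Tate), so what is open of C3′ at a cell curve is exactly (H): «the derived/Bockstein pairing of `θ` is the canonical
`Σ²` height up to a `2`-adic unit, with `[E(ℚ):E_𝒦]` as the universal-norm index» — research (Perrin-Riou 1992 §3.4, Schneider 1985
§§6–8; not in print at `2` over `ℚ`). Nothing here touches (H).

References: [GreenbergLNM1716] §3 Lemmas 3.3–3.5 (pp. 86–90), §4 p. 104, Lemma 4.7 (pp. 107–108), Prop. 4.13–4.14 (pp. 120–123);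
[MilneADT2006] I Thm. 4.10, Lemma 6.15, Thm. 6.13; [Cassels1964ArithmeticVII]; [PerrinRiou1992] §3.4; [Schneider1985] §§6–8.
bears_on: stmt-BirchSwinnertonDyer-23008 (helper; closes nothing), stmt-BirchSwinnertonDyer-22298 (attach seat's item; untouched).
-/

set_option autoImplicit false
-- the Theorems namespace of this sub repeats the summit name by design (D-0017 nested layout)
set_option linter.dupNamespace false

noncomputable section

open scoped Classical NumberField

open CategoryTheory Field NumberField IsDedekindDomain Function WeierstrassCurve
open Literature.NumberTheory.EllipticCurves Literature.NumberTheory.EllipticCurves.GreenbergSelmer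
open Literature.NumberTheory.GaloisRepresentations
open Literature.NumberTheory.GaloisRepresentations.DiscreteGaloisModule (SelmerStructure unramifiedSubgroup mu MuCarrier)
open Literature.NumberTheory.GaloisCohomology
open scoped ContRepresentation

namespace Summit.BirchSwinnertonDyer.BirchSwinnertonDyer.Theorems.AlignedTransportAtTwoEulerCharAtTwoKerGCell

open Summit.BirchSwinnertonDyer.Rank1Residual.X11b Summit.BirchSwinnertonDyer.Rank1Residual.X11b.KummerPT
open Summit.BirchSwinnertonDyer.Rank1Residual.X11b.LocBridge
open Summit.BirchSwinnertonDyer.Rank1Residual.X11b.Levels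
open Summit.BirchSwinnertonDyer.Rank1Residual.X11b.Relaxation
open Summit.BirchSwinnertonDyer.BirchSwinnertonDyer.Theorems.SignedEC.CasselsPT
open Summit.BirchSwinnertonDyer.BirchSwinnertonDyer.Theorems.AlignedTransportAtTwoEulerCharAtTwoKerGImage
open Summit.BirchSwinnertonDyer.BirchSwinnertonDyer.Theorems.AlignedTransportAtTwoEulerCharAtTwoKerGCassels
open Summit.BirchSwinnertonDyer.BirchSwinnertonDyer.Theorems.AlignedTransportAtTwoEulerCharAtTwoKerGShaExponent
open Summit.BirchSwinnertonDyer.BirchSwinnertonDyer.Theorems.AlignedTransportAtTwoEulerCharAtTwoKerGEmbedding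
open Summit.BirchSwinnertonDyer.BirchSwinnertonDyer.Theorems.AlignedTransportAtTwoEulerCharAtTwoAssemblyKummer
open Summit.BirchSwinnertonDyer.BirchSwinnertonDyer.Theorems.AlignedTransportAtTwoEulerCharAtTwoAssemblyDivisible
open ZpExtension Literature.NumberTheory.EllipticCurves.GreenbergVatsal2000 Summit.BirchSwinnertonDyer.Rank1Residual.X2
open Literature.NumberTheory.EllipticCurves.IwasawaAlgebra Literature.NumberTheory.EllipticCurves.IwasawaDual
open Literature.NumberTheory.EllipticCurves.Greenberg1999

/-! ## §1 The (L) identity on the cell -/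

section CellL

variable (W : WeierstrassCurve ℚ) [W.IsElliptic] [W.IsGloballyMinimal] (p : ℕ) [hp : Fact p.Prime]

/-- **At a good ORDINARY prime `p` of `W/ℚ` (cyclotomic `κ`) EVERY local kernel `𝒦_{v,0}[p^∞]` is finite**: Greenberg's Lemma 3.3 at
`v ∤ p` (tree `finite_localTowerKerPrimary_zero_of_not_mem`) and Lemma 3.4 at `v ∣ p` (tree `finite_localTowerKerPrimary_zero_of_ordinary`).
[cite: GreenbergLNM1716, §3 Lemmas 3.3–3.4 (pp. 86–89)] -/
theorem finite_localTowerKerPrimary_zero_of_isOrdinaryAt (hord : IsOrdinaryAt W p) (κ : ZpExtension ℚ p)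
    (hκ : κ.IsCyclotomic) (v : HeightOneSpectrum (𝓞 ℚ)) : Finite (W.localTowerKerPrimary κ (v.adicCompletion ℚ) 0) := by
  by_cases hpv : ((p : ℕ) : 𝓞 ℚ) ∈ v.asIdeal
  · exact W.finite_localTowerKerPrimary_zero_of_ordinary hpv
      (W.not_dvd_minimalDiscriminantInt_of_hasGoodReductionAtPrime' p hord.1) hord.2 κ hκ
  · exact W.finite_localTowerKerPrimary_zero_of_not_mem κ hpv

set_option maxHeartbeats 2000000 in -- instance-path unifications on the local cohomology groups (as in `…KerGIndex`)
/-- **THE (L) IDENTITY ON THE CELL (`K = ℚ`), NO BOOKKEEPING HYPOTHESIS.** `W/ℚ` globally minimal, `IsOrdinaryAt W p`, `E(ℚ)[p] = 0`,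
`κ` the cyclotomic `ℤ_p`-extension, `S` a finite set of primes containing `p` and the bad primes, `Ш(E/ℚ)[p^∞]` finite. Then there is a
level `k₀` such that at every level `k ≥ k₀`, for every Weil pairing `ew` on `E[p^k]` and every Poitou–Tate family `inv` at level `p^k`
(`IsPerfect`, `SumLocalTermEqZero`, `SelmerComplement`), there is a bi-additive `B : ∏_{v∈S} 𝒦_{v,0}[p^∞] →+ (E(ℚ) →+ ℤ/p^k)` computing
the point obstruction `∑_{v∈S} inv_v(t_v ∪ₑ loc_v κ_{p^k}P)` on every family of Kummer lifts, with `E(ℚ)/E_𝒦` finite for `E_𝒦 = ker B.flip`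
and **`#(A₀/Sel₀) · [E(ℚ) : E_𝒦] = ∏_{v∈S} #𝒦_{v,0}[p^∞]`**. (`p = 2` allowed: the C3′ cell.)
[cite: GreenbergLNM1716, §4 p. 104, Lemma 4.7 (pp. 107–108), Prop. 4.13 (pp. 120–123)] [cite: MilneADT2006, Ch. I, Thm. 4.10, Lemma 6.15,
Thm. 6.13] [cite: Cassels1964ArithmeticVII, Thm.] -/
theorem exists_level_kerIndexL_rat (hord : IsOrdinaryAt W p) (hK : ∀ P : W.toAffine.Point, p • P = 0 → P = 0)
    (κ : ZpExtension ℚ p) (hκ : κ.IsCyclotomic)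
    (S : Finset (HeightOneSpectrum (𝓞 ℚ))) (hS : ∀ v ∉ S, ((p : ℕ) : 𝓞 ℚ) ∉ v.asIdeal ∧ W.HasGoodReductionAt v)
    [Finite (AddCommGroup.primaryComponent (↥W.sha) p)] :
    -- the `K`-generic files carry the classical `DecidableEq` on `E(K)`; pinned here so that the statement is LITERALLY their
    -- specialisation to `K = ℚ` (consumers: `convert`, or work under the same `letI`)
    letI : DecidableEq ℚ := fun a b ↦ Classical.propDecidable (a = b)
    ∃ k₀ : ℕ, ∀ k : ℕ, k₀ ≤ k →
      ∀ (ew : W.geomTorsion ((p ^ k : ℕ) : ℤ) → W.geomTorsion ((p ^ k : ℕ) : ℤ) → AlgebraicClosure ℚ)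
        (hμ : ∀ S T, ew S T ^ (p ^ k) = 1)
        (hadd₁ : ∀ S₁ S₂ T, ew (S₁ + S₂) T = ew S₁ T * ew S₂ T)
        (hadd₂ : ∀ S T₁ T₂, ew S (T₁ + T₂) = ew S T₁ * ew S T₂)
        (hgal : ∀ (σ : absoluteGaloisGroup ℚ) (S T : W.geomTorsion ((p ^ k : ℕ) : ℤ)), σ • ew S T = ew (σ • S) (σ • T)),
        (∀ T, ew T T = 1) → (∀ T, (∀ S, ew S T = 1) → T = 0) →
      ∀ (inv : LocalInvariants ℚ (p ^ k)), inv.IsPerfect → inv.SumLocalTermEqZero → inv.SelmerComplement →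
      ∃ B : (∀ v : S, W.localTowerKerPrimary κ (v.1.adicCompletion ℚ) 0) →+ (W.toAffine.Point →+ ZMod (p ^ k)),
        (∀ (x : ∀ v : S, W.localTowerKerPrimary κ (v.1.adicCompletion ℚ) 0)
          (t : Π v : Place ℚ, galoisCohomology ((W.torsionGaloisModule ((p ^ k : ℕ) : ℤ)).toLocal v) 1),
          (∀ v : S,
            resH1Hom (Literature.NumberTheory.EllipticCurves.subgroupIncl
                (localSubgroup (⊤ : Subgroup (absoluteGaloisGroup ℚ)) (v.1.adicCompletion ℚ)))
              (AddMonoidHom.id (localPoints W (v.1.adicCompletion ℚ))) (fun _ _ ↦ rfl)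
              (galoisCohomology.map (W.torsionPointsMapIntertwining ((p ^ k : ℕ) : ℤ) (v.1.adicCompletion ℚ)) 1
                (t (Sum.inr v.1))) =
            Literature.NumberTheory.EllipticCurves.resOfLe (localPoints W (v.1.adicCompletion ℚ))
              (localSubgroup_top_le_layerSubgroup_zero κ (v.1.adicCompletion ℚ))
              ((x v : W.localTowerKerPrimary κ (v.1.adicCompletion ℚ) 0) :
                discreteH1 (localSubgroup (κ.layerSubgroup 0) (v.1.adicCompletion ℚ))
                  (localPoints W (v.1.adicCompletion ℚ)))) →
          ∀ P : W.toAffine.Point,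
            B x P = ∑ u ∈ S, invWeilPairing W (p ^ k) ew hμ hadd₁ hadd₂ hgal inv (Sum.inr u) (t (Sum.inr u))
              (galoisCohomology.localization (W.torsionGaloisModule ((p ^ k : ℕ) : ℤ)) (Sum.inr u) 1
                (kummerMapTorsion W ((p ^ k : ℕ) : ℤ)
                  (W.zsmul_geomPoints_surjective_holds (natCast_pow_ne_zero p k)) P))) ∧
        Finite (W.toAffine.Point ⧸ B.flip.ker) ∧
        Nat.card (W.KerG κ 0) * Nat.card (W.toAffine.Point ⧸ B.flip.ker) =
          ∏ v ∈ S, Nat.card (W.localTowerKerPrimary κ (v.adicCompletion ℚ) 0) :=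
  exists_level_pointObstructionHom_natCard_kerG_zero_mul_eq_prod W p κ hκ
    (W.natCard_fixedPoints_absoluteGaloisGroup_geomPrimaryTorsion_eq_one (p := p) fun P hP ↦ hK P (by convert hP)) S hS
    (fun v _ ↦ finite_localTowerKerPrimary_zero_of_isOrdinaryAt W p hord κ hκ v)

/-- **The Cassels–Poitou–Tate index is `i_S = (∏_{v∈S} #𝒦_{v,0}[p^∞]) / #(A₀/Sel₀)`** (any number field): for ANY finite quotient `Q` of
`E(K)` (e.g. `Q = E(K)/E_𝒦`, `E_𝒦 = ker B.flip` of `exists_level_kerIndexL_rat`) with `#(A₀/Sel₀) · #Q = ∏_{v∈S} #𝒦_{v,0}[p^∞]` and `A₀/Sel₀`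
finite (automatic at a good ordinary `p` over `ℚ`, tree `finite_kerG_zero_of_isOrdinaryAt`), `#Q = (∏_{v∈S} #𝒦_{v,0}[p^∞]) / #(A₀/Sel₀)` — so
the index does not depend on the level, the Weil pairing or the Poitou–Tate family. [cite: GreenbergLNM1716, §4 Lemma 4.7 (pp. 107–108)] -/
theorem natCard_quotient_eq_prod_div_natCard_kerG {K : Type} [Field K] [NumberField K] (V : WeierstrassCurve K)
    (κ : ZpExtension K p) [Finite (V.KerG κ 0)] (S : Finset (HeightOneSpectrum (𝓞 K))) {Q : Type*} [Finite Q]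
    (hN : Nat.card (V.KerG κ 0) * Nat.card Q = ∏ v ∈ S, Nat.card (V.localTowerKerPrimary κ (v.adicCompletion K) 0)) :
    Nat.card Q = (∏ v ∈ S, Nat.card (V.localTowerKerPrimary κ (v.adicCompletion K) 0)) / Nat.card (V.KerG κ 0) := by
  have h0 : 0 < Nat.card (V.KerG κ 0) := Nat.card_pos
  rw [← hN, Nat.mul_div_cancel_left _ h0]

end CellL

/-! ## §2 The open stub of C3′ at a cell curve ⟺ the height-index identity (H), modulo the two PRINT inputs -/

section CellH

variable (W : WeierstrassCurve ℚ) [W.IsElliptic] [W.IsGloballyMinimal]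

/-- Bookkeeping in `ℚ_[2]`: with `a ≠ 0` and `P = a · i`, `x · a · L = c · P'` and `P' = P` give `x · L = c · i`, and conversely. [folklore] -/
theorem mul_cancel_bookkeeping {x a L c P' : ℚ_[2]} {i : ℚ_[2]} (ha : a ≠ 0) (hP : P' = a * i) :
    x * a * L = c * P' ↔ x * L = c * i := by
  rw [hP]
  constructor
  · intro h
    have h' : a * (x * L) = a * (c * i) := by linear_combination h
    exact mul_left_cancel₀ ha h'
  · intro h
    linear_combination a * h

set_option maxHeartbeats 2000000 in
/-- **THE OPEN STUB OF C3′ AT A CELL CURVE ⟺ THE HEIGHT-INDEX IDENTITY (H)** (CONDITIONAL on the two PRINT inputs of the line: Greenberg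
Prop. 4.14 / Hachimori–Matsuno Cor. (i) at `2`, hypothesis `h414` exactly as in att-p4's KI; and the LOCAL ORDERS at `2`, Greenberg Lemma 3.3
(value `c_v^{(2)}` at a bad `v`) and Lemma 3.4 (`#Ẽ(𝔽₂)(2)²` at `v = 2`), hypothesis `hloc` on the product over `S`; closes nothing).
For `W/ℚ` globally minimal, `IsOrdinaryAt W 2`, `E(ℚ)[2] = 0`, `2 ∤ #E(ℚ)_tors`, `S ⊇ {2} ∪ {bad}`:
`SchneiderLeadingTermFormulaAtTwoSqAt W` holds IFF for every cyclotomic datum `(κ, γ)`, every finitely generated torsion strict dual `D`, THE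
`Σ²` height `Dh` with `Reg₂(Dh) ≠ 0`, `Ш(E/ℚ)(2)` finite, and every `e`, `e₀`, `κ_M : M ↪ Sel_{2^∞}(E/ℚ)` (cokernel of order `#Ш(2)`), the
derived Kummer map `θ` has finite kernel, TRIVIAL cokernel, and
**`#ker θ · (log₂5)^{rank E(ℚ)} = u · Reg₂(Dh) · i_S`**, `u ∈ ℤ₂ˣ`, where **`i_S = (∏_{v∈S} #𝒦_{v,0}[2^∞]) / #(A₀/Sel₀)`** is the
Cassels–Poitou–Tate index `[E(ℚ) : E_𝒦]` of §1 (`exists_level_kerIndexL_rat`, `natCard_quotient_eq_prod_div_natCard_kerG`). Proof: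
KI (`…AssemblyDivisible.schneiderLeadingTermFormulaAtTwoSqAt_iff_kerIndexAt_of_prop414`) multiplied through by `i_S`, using
`#(A₀/Sel₀) · i_S = ∏ #𝒦 = 2^{v₂(∏c_v)} · #Ẽ(𝔽₂)(2)²` (Lagrange + `hloc`) and `#(A₀/Sel₀) ≠ 0`. READING: the residual of C3′ at a cell
curve is (H) ALONE — «the Bockstein pairing of `θ` is the canonical `Σ²` height up to a `2`-adic unit, with universal-norm index
`[E(ℚ):E_𝒦]`» (Perrin-Riou 1992 §3.4 / Schneider 1985 for odd `p`; not in print at `2`). BSD is not proved; nothing is closed.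
[cite: GreenbergLNM1716, §3 Lemmas 3.3–3.4, §4 Lemmas 4.2–4.7, Prop. 4.14] [cite: HachimoriMatsuno2000, Cor. (i)]
[cite: PerrinRiou1992, §3.4] [cite: Schneider1985, §§6–8] -/
theorem schneiderLeadingTermFormulaAtTwoSqAt_iff_heightIndexAt_of_prop414_of_localOrders
    (h414 : prop414_noFiniteSubmodule_of_not_dvd_torsionOrder)
    (hK : ∀ P : W.toAffine.Point, 2 • P = 0 → P = 0) (h2 : ¬ 2 ∣ W.torsionOrder) (hord : IsOrdinaryAt W 2)
    (S : Finset (HeightOneSpectrum (𝓞 ℚ))) (hS : ∀ v ∉ S, ((2 : ℕ) : 𝓞 ℚ) ∉ v.asIdeal ∧ W.HasGoodReductionAt v)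
    (hloc : ∀ κ : ZpExtension ℚ 2, κ.IsCyclotomic →
      ∏ v ∈ S, Nat.card (W.localTowerKerPrimary κ (v.adicCompletion ℚ) 0) =
        2 ^ padicValNat 2 W.tamagawaProduct *
          Nat.card (AddCommGroup.primaryComponent
            ((integralModelInt W).map (Int.castRingHom (ZMod 2))).toAffine.Point 2) ^ 2) :
    Summit.BirchSwinnertonDyer.Rank1Residual.F1Sign2.SchneiderLeadingTermFormulaAtTwoSqAt W ↔
    (∀ (κ : ZpExtension ℚ 2) (γ : Field.absoluteGaloisGroup ℚ),
        κ.IsCyclotomic → κ.IsTopGenerator γ → IsCyclotomicVariable 2 γ →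
      ∀ (D : W.SelmerDualData κ γ) [Module.Finite (IwasawaAlgebra 2) D.X], D.IsTorsion →
      ∀ (Dh : PAdicHeightData W 2), Dh.IsCanonicalSq →
        SchneiderConjecture Dh → Finite (AddCommGroup.primaryComponent W.sha 2) →
      ∀ (e : ↥(W.selmerInfty κ ⊓ W.layerInvariants κ 0) ≃+ ↥(endInvariants (W.conjSelmerInfty κ γ - 1)))
        (e₀ : ↥(W.selmerGroupPInfty 2) ≃+ ↥(W.selmerLayer κ 0))
        (M : Type) [AddCommGroup M] (kS : M →+ ↥(W.selmerGroupPInfty 2)), Function.Injective kS →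
        Nat.card (↥(W.selmerGroupPInfty 2) ⧸ kS.range) = Nat.card (AddCommGroup.primaryComponent W.sha 2) →
      ∀ (θ : M →+ EndCoinvariants (W.conjSelmerInfty κ γ - 1)),
        θ = (W.selmerInftyEulerMap κ γ).comp
          (((e : ↥(W.selmerInfty κ ⊓ W.layerInvariants κ 0) →+ ↥(endInvariants (W.conjSelmerInfty κ γ - 1))).comp (W.sMap κ 0)).comp
            ((e₀ : ↥(W.selmerGroupPInfty 2) →+ ↥(W.selmerLayer κ 0)).comp kS)) →
        Finite θ.ker ∧ Nat.card (EndCoinvariants (W.conjSelmerInfty κ γ - 1) ⧸ θ.range) = 1 ∧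
        ∃ u : ℤ_[2]ˣ,
          (Nat.card θ.ker : ℚ_[2]) * padicLog 2 (cyclotomicGenerator 2) ^ W.mordellWeilRank =
            ((u : ℤ_[2]) : ℚ_[2]) * padicRegulator Dh *
              (((∏ v ∈ S, Nat.card (W.localTowerKerPrimary κ (v.adicCompletion ℚ) 0)) / Nat.card (W.KerG κ 0) : ℕ) : ℚ_[2])) := by
  refine (schneiderLeadingTermFormulaAtTwoSqAt_iff_kerIndexAt_of_prop414 W h414 hK h2 hord).trans ⟨?_, ?_⟩
  · intro h κ γ hκ hγ hγ' D _ hX Dh hDh hS' hSha e e₀ M _ kS hkS hkS' θ hθ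
    obtain ⟨hk, h1, u, hu⟩ := h κ γ hκ hγ hγ' D hX Dh hDh hS' hSha e e₀ M kS hkS hkS' θ hθ
    refine ⟨hk, h1, u, ?_⟩
    haveI : Finite (W.KerG κ 0) := finite_kerG_zero_of_isOrdinaryAt W hord κ hκ
    have ha : (Nat.card (W.KerG κ 0) : ℚ_[2]) ≠ 0 := by exact_mod_cast Nat.card_pos.ne'
    have hdvd := natCard_kerG_zero_dvd_prod_rat 2 W κ S hS
    have hP : ((2 : ℚ_[2]) ^ padicValNat 2 W.tamagawaProduct *
        (Nat.card (AddCommGroup.primaryComponent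
          ((integralModelInt W).map (Int.castRingHom (ZMod 2))).toAffine.Point 2) : ℚ_[2]) ^ 2) =
        (Nat.card (W.KerG κ 0) : ℚ_[2]) *
          (((∏ v ∈ S, Nat.card (W.localTowerKerPrimary κ (v.adicCompletion ℚ) 0)) / Nat.card (W.KerG κ 0) : ℕ) : ℚ_[2]) := by
      rw [← Nat.cast_mul, Nat.mul_div_cancel' hdvd, hloc κ hκ]
      push_cast
      ring
    have hu' : (Nat.card θ.ker : ℚ_[2]) * Nat.card (W.KerG κ 0) * padicLog 2 (cyclotomicGenerator 2) ^ W.mordellWeilRank =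
        ((u : ℤ_[2]) : ℚ_[2]) * padicRegulator Dh *
          ((2 : ℚ_[2]) ^ padicValNat 2 W.tamagawaProduct *
            (Nat.card (AddCommGroup.primaryComponent
              ((integralModelInt W).map (Int.castRingHom (ZMod 2))).toAffine.Point 2) : ℚ_[2]) ^ 2) := by
      rw [hu]; ring
    exact (mul_cancel_bookkeeping ha hP).mp hu'
  · intro h κ γ hκ hγ hγ' D _ hX Dh hDh hS' hSha e e₀ M _ kS hkS hkS' θ hθ
    obtain ⟨hk, h1, u, hu⟩ := h κ γ hκ hγ hγ' D hX Dh hDh hS' hSha e e₀ M kS hkS hkS' θ hθ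
    refine ⟨hk, h1, u, ?_⟩
    haveI : Finite (W.KerG κ 0) := finite_kerG_zero_of_isOrdinaryAt W hord κ hκ
    have ha : (Nat.card (W.KerG κ 0) : ℚ_[2]) ≠ 0 := by exact_mod_cast Nat.card_pos.ne'
    have hdvd := natCard_kerG_zero_dvd_prod_rat 2 W κ S hS
    have hP : ((2 : ℚ_[2]) ^ padicValNat 2 W.tamagawaProduct *
        (Nat.card (AddCommGroup.primaryComponent
          ((integralModelInt W).map (Int.castRingHom (ZMod 2))).toAffine.Point 2) : ℚ_[2]) ^ 2) =
        (Nat.card (W.KerG κ 0) : ℚ_[2]) *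
          (((∏ v ∈ S, Nat.card (W.localTowerKerPrimary κ (v.adicCompletion ℚ) 0)) / Nat.card (W.KerG κ 0) : ℕ) : ℚ_[2]) := by
      rw [← Nat.cast_mul, Nat.mul_div_cancel' hdvd, hloc κ hκ]
      push_cast
      ring
    have key := (mul_cancel_bookkeeping (x := (Nat.card θ.ker : ℚ_[2]))
      (L := padicLog 2 (cyclotomicGenerator 2) ^ W.mordellWeilRank)
      (c := ((u : ℤ_[2]) : ℚ_[2]) * padicRegulator Dh) ha hP).mpr hu
    rw [key]
    ring

end CellH

end Summit.BirchSwinnertonDyer.BirchSwinnertonDyer.Theorems.AlignedTransportAtTwoEulerCharAtTwoKerGCell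

end
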